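import Literature.RingTheory.RegularLocalRing.QuotientDVR
import Summits.ResolutionOfSingularities.ResolutionOfSingularities.Theorems.EquisingularLiftEquisingularLiftLinkedNode
import Mathlib.RingTheory.Ideal.KrullsHeightTheorem
import Mathlib.RingTheory.Ideal.MinimalPrime.Noetherian
import Mathlib.RingTheory.Nakayama
import HarnessLib

/-!
# [OURS · L1 W4.5(b) · EL♮] T-MULTISEC ring brick B1: a DVR quotient of a regular local ring through a
# prescribed cotangent direction, avoiding a prescribed non-zero element (crux `EquisingularLiftNat` =
# stmt-ResolutionOfSingularities-20038)

HONEST FRAMING. OURS (cell res-hironaka, crux chain w45b, slot W4.5(b)); NOT a statement of any manuscript;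
AI-written, weaker than expert review. Helper `--supports stmt-ResolutionOfSingularities-20038 --as helper`; it
closes nothing. Object = ring brick **B1** of res-D-pv-003's T-MULTISEC (STATUS 2026-08-27T06:59:44Z «097 take the
ring core», exact signature fixed there; consumer: res-D-pv-003's `multisection_of_prime` / (MS)-corollary, which needs a
prime `𝔭 ⊂ 𝒪_{P,b}` with `𝒪_{P,b} ⧸ 𝔭` a DVR, the uniformizer `ϖ` of the base not in `𝔭`, and the TRACE ADDENDUM
`𝔭 + (u) = 𝔪`). Pure commutative algebra; no scheme appears in this file.

CONTENT. Refinement of the tree's `exists_isPrime_isDiscreteValuationRing_quotient`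
(`Literature/RingTheory/RegularLocalRing/QuotientDVR.lean`): for a regular local ring `(R, 𝔪)`, an element
`u ∈ 𝔪 ∖ 𝔪²` and a non-zero element `ϖ`, **there is a prime ideal `𝔭` with `R/𝔭` a discrete valuation ring,
`ϖ ∉ 𝔭` and `𝔭 + (u) = 𝔪`** (`exists_isPrime_isDiscreteValuationRing_quotient_not_mem`; so the image of `u` is a
uniformizer of `R/𝔭` and the image of `ϖ` is non-zero), and the `u`-free form
`exists_isPrime_isDiscreteValuationRing_quotient_not_mem_of_ne_zero` (`dim R ≠ 0`, `ϖ ≠ 0`). Geometrically: through a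
point of a regular scheme there is a regular curve germ, tangent to a prescribed cotangent direction `u`, not contained
in the hypersurface `ϖ = 0`.

PROOF (folklore; Matsumura, *Commutative Ring Theory*, Thm. 14.2 for the cutting step, prime avoidance Ex. 1.6,
Krull's principal ideal theorem Thm. 13.5): induction on `dim R` through `R ↦ R/(x)` as in `QuotientDVR.lean`, where
now the cut element `x ∈ 𝔪` is chosen by prime avoidance outside `𝔪² + (u)` (possible since `dim R ≥ 2` forces
`𝔪 ≠ 𝔪² + (u)`, Nakayama: `not_maximalIdeal_le_sq_sup_span_singleton`) and outside the finitely many minimal primes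
over `(ϖ)` (each of height `≤ 1 < dim R`: `ne_maximalIdeal_of_mem_minimalPrimes_span_singleton`) —
`exists_mem_maximalIdeal_not_mem_sq_sup_not_mem_minimalPrimes`; then `ϖ ∉ (x)` (a minimal prime over `(ϖ)` inside
the prime `(x)` but not containing `x` would be zero by Nakayama: `not_mem_span_singleton_of_forall_minimalPrimes_not_mem`),
the image of `u` stays outside `𝔪̄²` (`not_mem_sq_sup_span_singleton_of_not_mem`, tree `mk_mem_sq_maximalIdeal_quotient_iff` of
`…Theorems/EquisingularLiftEquisingularLiftLinkedNode.lean`),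
and the prime of `R/(x)` given by the induction hypothesis is pulled back. In dimension one `𝔭 = 0` and `u` is a
uniformizer (`maximalIdeal_eq_span_singleton_of_not_mem_sq`).
Mathlib searched (pin): `Ideal.subset_union_prime`, `Ideal.height_le_one_of_isPrincipal_of_mem_minimalPrimes`,
`Ideal.finite_minimalPrimes_of_isNoetherianRing`, `Submodule.eq_bot_of_le_smul_of_le_jacobson_bot`,
`Submodule.le_of_le_smul_of_le_jacobson_bot`, `IsDiscreteValuationRing.irreducible_iff_uniformizer`; tree:
`IsRegularLocalRing.quotient_span_singleton`, `IsRegularLocalRing.prime_of_not_mem_sq`, `maximalIdeal_quotient_eq_map`,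
`isDiscreteValuationRing_of_ringKrullDim_eq_one`, `isDiscreteValuationRing_of_ringEquiv`.

References: H. Matsumura, *Commutative Ring Theory*, Cambridge Studies in Advanced Mathematics 8 (1986): Ex. 1.6
(prime avoidance), Thm. 13.5, Thm. 14.2 [Matsumura1987] — through Mathlib and the cited tree files.
-/

set_option linter.dupNamespace false -- mandated namespace `Summit.<Summit>.<Problem>` of this single-conjunct summit

universe u

open IsLocalRing

namespace Summit.ResolutionOfSingularities.ResolutionOfSingularities.Cruxes.EquisingularLiftNat.Sections

open Literature.AlgebraicGeometry.Resolution Literature.RingTheory.RegularLocalRing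
open Summit.ResolutionOfSingularities.ResolutionOfSingularities.Cruxes.EquisingularLift.StrataSplit
  (mk_mem_sq_maximalIdeal_quotient_iff)

variable {R : Type u} [CommRing R]

/-- In a local ring, an element of `𝔪 ∖ 𝔪²` is irreducible: it is a non-unit, and in a
factorisation `u = a * b` with both factors non-units we would have `u ∈ 𝔪·𝔪 = 𝔪²`.
[folklore] -/
theorem irreducible_of_mem_maximalIdeal_not_mem_sq [IsLocalRing R] {u : R}
    (hu : u ∈ maximalIdeal R) (hu2 : u ∉ maximalIdeal R ^ 2) : Irreducible u := by
  refine irreducible_iff.mpr ⟨fun h => (mem_maximalIdeal u).mp hu h, fun a b hab => ?_⟩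
  by_contra h
  obtain ⟨ha, hb⟩ := not_or.mp h
  apply hu2
  rw [hab, pow_two]
  exact Ideal.mul_mem_mul ((mem_maximalIdeal a).mpr ha) ((mem_maximalIdeal b).mpr hb)

/-- In a discrete valuation ring an element of `𝔪 ∖ 𝔪²` is a uniformizer: `𝔪 = (u)`.
[folklore] -/
theorem maximalIdeal_eq_span_singleton_of_not_mem_sq [IsDomain R] [IsDiscreteValuationRing R]
    {u : R} (hu : u ∈ maximalIdeal R) (hu2 : u ∉ maximalIdeal R ^ 2) :
    maximalIdeal R = Ideal.span {u} :=
  (IsDiscreteValuationRing.irreducible_iff_uniformizer u).mp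
    (irreducible_of_mem_maximalIdeal_not_mem_sq hu hu2)

/-- In a regular local ring of dimension `≥ 2`, for `u ∈ 𝔪` the ideal `𝔪² + (u)` does not
contain `𝔪` (otherwise `𝔪 = (u)` by Nakayama and `emb dim R ≤ 1`). [folklore] -/
theorem not_maximalIdeal_le_sq_sup_span_singleton [IsRegularLocalRing R]
    (h2 : (2 : WithBot ℕ∞) ≤ ringKrullDim R) {u : R} (hu : u ∈ maximalIdeal R) :
    ¬ maximalIdeal R ≤ maximalIdeal R ^ 2 ⊔ Ideal.span {u} := by
  intro hle
  have hjac : maximalIdeal R ≤ Ideal.jacobson ⊥ :=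
    le_of_eq (IsLocalRing.jacobson_eq_maximalIdeal ⊥ bot_ne_top).symm
  have hle' : maximalIdeal R ≤ Ideal.span {u} ⊔ maximalIdeal R • maximalIdeal R := by
    rwa [smul_eq_mul, ← pow_two, sup_comm]
  have h1 : maximalIdeal R ≤ Ideal.span {u} :=
    Submodule.le_of_le_smul_of_le_jacobson_bot (IsNoetherian.noetherian _) hjac hle'
  have heq : maximalIdeal R = Ideal.span {u} :=
    le_antisymm h1 ((Ideal.span_singleton_le_iff_mem _).mpr hu)
  have hfin : (maximalIdeal R).spanFinrank ≤ 1 := by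
    rw [heq]
    refine (Submodule.spanFinrank_span_le_ncard_of_finite (Set.finite_singleton u)).trans ?_
    rw [Set.ncard_singleton]
  have hreg := (isRegularLocalRing_iff R).mp ‹_›
  rw [← hreg] at h2
  have h2' : 2 ≤ (maximalIdeal R).spanFinrank := by exact_mod_cast h2
  omega

/-- In a Noetherian local ring of dimension `≥ 2`, a minimal prime over a principal ideal is not
the maximal ideal (Krull's principal ideal theorem: its height is `≤ 1`).
[cite: Matsumura1987, Thm. 13.5] -/
theorem ne_maximalIdeal_of_mem_minimalPrimes_span_singleton [IsNoetherianRing R] [IsLocalRing R]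
    (h2 : (2 : WithBot ℕ∞) ≤ ringKrullDim R) {ϖ : R} {Q : Ideal R}
    (hQ : Q ∈ (Ideal.span {ϖ}).minimalPrimes) : Q ≠ maximalIdeal R := by
  intro hQm
  have h1 := Ideal.height_le_one_of_isPrincipal_of_mem_minimalPrimes (Ideal.span {ϖ}) Q hQ
  rw [hQm] at h1
  have h1' : ((maximalIdeal R).height : WithBot ℕ∞) ≤ ((1 : ℕ∞) : WithBot ℕ∞) :=
    WithBot.coe_le_coe.mpr h1
  rw [maximalIdeal_height_eq_ringKrullDim] at h1'
  have h21 : (2 : WithBot ℕ∞) ≤ ((1 : ℕ∞) : WithBot ℕ∞) := h2.trans h1'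
  exact absurd h21 (by decide)

/-- **Choice of the cut element.** In a regular local ring of dimension `≥ 2`, for `u ∈ 𝔪` and
any `ϖ` there is `x ∈ 𝔪` outside `𝔪² + (u)` and outside every minimal prime over `(ϖ)` (prime
avoidance with the one non-prime ideal `𝔪² + (u)`). [cite: Matsumura1987, Ex. 1.6] -/
theorem exists_mem_maximalIdeal_not_mem_sq_sup_not_mem_minimalPrimes [IsRegularLocalRing R]
    (h2 : (2 : WithBot ℕ∞) ≤ ringKrullDim R) {u : R} (hu : u ∈ maximalIdeal R) (ϖ : R) :
    ∃ x ∈ maximalIdeal R, x ∉ maximalIdeal R ^ 2 ⊔ Ideal.span {u} ∧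
      ∀ Q ∈ (Ideal.span {ϖ}).minimalPrimes, x ∉ Q := by
  classical
  have hfin := Ideal.finite_minimalPrimes_of_isNoetherianRing R (Ideal.span {ϖ})
  set J : Ideal R := maximalIdeal R ^ 2 ⊔ Ideal.span {u} with hJ
  let s : Finset (Ideal R) := insert J hfin.toFinset
  have hp : ∀ i ∈ s, i ≠ J → i ≠ J → (id i : Ideal R).IsPrime := by
    intro i hi hiJ _
    rcases Finset.mem_insert.mp hi with h | h
    · exact absurd h hiJ
    · exact (hfin.mem_toFinset.mp h).1.1
  have hnot : ¬ ∃ i ∈ s, maximalIdeal R ≤ id i := by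
    rintro ⟨i, hi, hle⟩
    rcases Finset.mem_insert.mp hi with h | h
    · subst h
      exact not_maximalIdeal_le_sq_sup_span_singleton h2 hu hle
    · have hiQ := hfin.mem_toFinset.mp h
      simp only [id] at hle
      have : i = maximalIdeal R :=
        ((IsLocalRing.maximalIdeal.isMaximal R).eq_of_le hiQ.1.1.ne_top hle).symm
      exact ne_maximalIdeal_of_mem_minimalPrimes_span_singleton h2 hiQ this
  rw [← Ideal.subset_union_prime J J hp, Set.not_subset] at hnot
  obtain ⟨x, hxm, hx⟩ := hnot
  refine ⟨x, hxm, ?_, ?_⟩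
  · intro hxJ
    apply hx
    exact Set.mem_biUnion (Finset.mem_coe.mpr (Finset.mem_insert_self J _)) hxJ
  · intro Q hQ hxQ
    apply hx
    exact Set.mem_biUnion
      (Finset.mem_coe.mpr (Finset.mem_insert_of_mem (hfin.mem_toFinset.mpr hQ))) hxQ

/-- **Exchange.** In a local ring, if `u ∉ 𝔪²` and `x ∈ 𝔪 ∖ (𝔪² + (u))`, then `u ∉ 𝔪² + (x)`:
from `u = a·x + b`, `b ∈ 𝔪²`, either `a ∈ 𝔪` and `u ∈ 𝔪²`, or `a` is a unit and
`x ∈ 𝔪² + (u)`. [folklore] -/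
theorem not_mem_sq_sup_span_singleton_of_not_mem [IsLocalRing R] {u x : R}
    (hu2 : u ∉ maximalIdeal R ^ 2) (hxm : x ∈ maximalIdeal R)
    (hx : x ∉ maximalIdeal R ^ 2 ⊔ Ideal.span {u}) :
    u ∉ maximalIdeal R ^ 2 ⊔ Ideal.span {x} := by
  intro h
  rw [sup_comm] at h
  obtain ⟨a, b, hb, hab⟩ := Ideal.mem_span_singleton_sup.mp h
  by_cases ha : IsUnit a
  · obtain ⟨a', rfl⟩ := ha
    apply hx
    have hx' : x = (↑a'⁻¹ : R) * (u - b) := by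
      rw [← hab, add_sub_cancel_right, ← mul_assoc, Units.inv_mul, one_mul]
    rw [hx']
    exact Ideal.mul_mem_left _ _ (Ideal.sub_mem _
      (Ideal.mem_sup_right (Ideal.mem_span_singleton_self u)) (Ideal.mem_sup_left hb))
  · apply hu2
    rw [← hab]
    refine Ideal.add_mem _ ?_ hb
    rw [pow_two]
    exact Ideal.mul_mem_mul ((mem_maximalIdeal a).mpr ha) hxm

/-- **The cut avoids `ϖ`.** In a Noetherian local ring, if `x ∈ 𝔪` generates a prime ideal,
`ϖ ≠ 0`, and `x` lies in no minimal prime over `(ϖ)`, then `ϖ ∉ (x)`: otherwise a minimal prime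
`Q` over `(ϖ)` with `Q ⊆ (x)`, `x ∉ Q` satisfies `Q = x·Q`, hence `Q = 0` by Nakayama, against
`0 ≠ ϖ ∈ Q`. [folklore] -/
theorem not_mem_span_singleton_of_forall_minimalPrimes_not_mem [IsNoetherianRing R]
    [IsLocalRing R] {x ϖ : R} (hxm : x ∈ maximalIdeal R) (hxp : (Ideal.span {x}).IsPrime)
    (hϖ0 : ϖ ≠ 0) (havoid : ∀ Q ∈ (Ideal.span {ϖ}).minimalPrimes, x ∉ Q) :
    ϖ ∉ Ideal.span {x} := by
  intro hϖx
  have hle : Ideal.span {ϖ} ≤ Ideal.span {x} := (Ideal.span_singleton_le_iff_mem _).mpr hϖx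
  obtain ⟨Q, hQ, hQle⟩ := Ideal.exists_minimalPrimes_le hle
  haveI := hQ.1.1
  have hxQ : x ∉ Q := havoid Q hQ
  have hjac : Ideal.span {x} ≤ Ideal.jacobson ⊥ := by
    rw [IsLocalRing.jacobson_eq_maximalIdeal ⊥ bot_ne_top]
    exact (Ideal.span_singleton_le_iff_mem _).mpr hxm
  have hQle' : Q ≤ Ideal.span {x} • Q := by
    intro q hq
    obtain ⟨r, rfl⟩ := Ideal.mem_span_singleton'.mp (hQle hq)
    have hr : r ∈ Q := ((Ideal.IsPrime.mem_or_mem inferInstance hq).resolve_right hxQ)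
    rw [smul_eq_mul, mul_comm r x]
    exact Ideal.mul_mem_mul (Ideal.mem_span_singleton_self x) hr
  have hQbot : Q = ⊥ :=
    Submodule.eq_bot_of_le_smul_of_le_jacobson_bot (Ideal.span {x}) Q (IsNoetherian.noetherian Q)
      hQle' hjac
  have hϖQ : ϖ ∈ Q := hQ.1.2 (Ideal.mem_span_singleton_self ϖ)
  rw [hQbot, Ideal.mem_bot] at hϖQ
  exact hϖ0 hϖQ

/-- **A regular local ring has a DVR quotient through a prescribed cotangent direction avoiding a
prescribed non-zero element.** For `(R, 𝔪)` regular local, `u ∈ 𝔪 ∖ 𝔪²` and `ϖ ≠ 0` there is a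
prime ideal `𝔭` with `R/𝔭` a discrete valuation ring, `ϖ ∉ 𝔭` and `𝔭 + (u) = 𝔪`
(dimension one: `𝔭 = 0` and `u` is a uniformizer; dimension `≥ 2`: cut by an `x ∈ 𝔪` outside
`𝔪² + (u)` and outside the minimal primes over `(ϖ)`, and pull back from `R/(x)`, which is regular
local of one dimension less by Matsumura Thm. 14.2). [folklore] -/
theorem exists_isPrime_isDiscreteValuationRing_quotient_not_mem (R : Type u) [CommRing R]
    [IsRegularLocalRing R] {u ϖ : R} (hu : u ∈ maximalIdeal R) (hu2 : u ∉ maximalIdeal R ^ 2)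
    (hϖ0 : ϖ ≠ 0) :
    ∃ (p : Ideal R) (_ : p.IsPrime), IsDiscreteValuationRing (R ⧸ p) ∧ ϖ ∉ p ∧
      p ⊔ Ideal.span {u} = maximalIdeal R := by
  obtain ⟨n, hn⟩ := exists_nat_cast_eq_ringKrullDim (R := R)
  induction n generalizing R with
  | zero =>
    -- dimension zero: `𝔪 = 0`, contradicting `u ∈ 𝔪 ∖ 𝔪²`
    exfalso
    have hreg := (isRegularLocalRing_iff R).mp ‹_›
    rw [hn, Nat.cast_zero] at hreg
    have h0 : (maximalIdeal R).spanFinrank = 0 := by exact_mod_cast hreg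
    have hbot : maximalIdeal R = ⊥ :=
      (Submodule.spanFinrank_eq_zero_iff_eq_bot (IsNoetherian.noetherian _)).mp h0
    rw [hbot, Ideal.mem_bot] at hu
    subst hu
    exact hu2 (Ideal.zero_mem _)
  | succ n ih =>
    rcases Nat.eq_zero_or_pos n with hz | hpos
    · -- dimension one: `𝔭 = 0`, `u` is a uniformizer
      subst hz
      haveI := isDomain_of_isRegularLocalRing R
      haveI : IsDiscreteValuationRing R :=
        isDiscreteValuationRing_of_ringKrullDim_eq_one (by rw [hn]; rfl)
      refine ⟨⊥, Ideal.isPrime_bot,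
        isDiscreteValuationRing_of_ringEquiv (RingEquiv.quotientBot R).symm, ?_, ?_⟩
      · rwa [Ideal.mem_bot]
      · rw [bot_sup_eq]
        exact (maximalIdeal_eq_span_singleton_of_not_mem_sq hu hu2).symm
    · -- dimension `≥ 2`: cut by a well-chosen `x ∈ 𝔪 ∖ 𝔪²` and induct
      obtain ⟨n', rfl⟩ : ∃ n', n = n' + 1 := ⟨n - 1, (Nat.succ_pred_eq_of_pos hpos).symm⟩
      have h2 : (2 : WithBot ℕ∞) ≤ ringKrullDim R := by
        rw [hn]
        exact_mod_cast (by omega : 2 ≤ n' + 1 + 1)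
      obtain ⟨x, hxm, hxJ, hxavoid⟩ :=
        exists_mem_maximalIdeal_not_mem_sq_sup_not_mem_minimalPrimes h2 hu ϖ
      have hx2 : x ∉ maximalIdeal R ^ 2 := fun h => hxJ (Ideal.mem_sup_left h)
      have hx0 : x ≠ 0 := by rintro rfl; exact hx2 (Ideal.zero_mem _)
      obtain ⟨hreg, hdim⟩ := IsRegularLocalRing.quotient_span_singleton hxm hx2
      haveI := hreg
      have hdim' : ringKrullDim (R ⧸ Ideal.span {x}) = (n' + 1 : ℕ) := by
        obtain ⟨m, hm⟩ := exists_nat_cast_eq_ringKrullDim (R := R ⧸ Ideal.span {x})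
        rw [hm, hn] at hdim
        have : (m : WithBot ℕ∞) + 1 = ((m + 1 : ℕ) : WithBot ℕ∞) := by push_cast; rfl
        rw [this] at hdim
        have hmn : m + 1 = n' + 1 + 1 := by exact_mod_cast hdim
        rw [hm]
        congr 1
        exact_mod_cast Nat.succ_injective hmn
      -- the images of `u` and `ϖ` in `R/(x)`
      set π := Ideal.Quotient.mk (Ideal.span {x}) with hπ
      have hū : π u ∈ maximalIdeal (R ⧸ Ideal.span {x}) := by
        rw [maximalIdeal_quotient_eq_map (Ideal.span {x})]
        exact Ideal.mem_map_of_mem _ hu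
      have hū2 : π u ∉ maximalIdeal (R ⧸ Ideal.span {x}) ^ 2 := by
        rw [mk_mem_sq_maximalIdeal_quotient_iff]
        exact not_mem_sq_sup_span_singleton_of_not_mem hu2 hxm hxJ
      have hxp : (Ideal.span {x}).IsPrime :=
        (Ideal.span_singleton_prime hx0).mpr (IsRegularLocalRing.prime_of_not_mem_sq hxm hx2)
      have hϖx : ϖ ∉ Ideal.span {x} :=
        not_mem_span_singleton_of_forall_minimalPrimes_not_mem hxm hxp hϖ0 hxavoid
      have hϖbar : π ϖ ≠ 0 := fun h => hϖx (Ideal.Quotient.eq_zero_iff_mem.mp h)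
      -- induction hypothesis on `R/(x)` and pull-back
      obtain ⟨p', hp', hdvr, hϖp', hsup'⟩ := ih (R ⧸ Ideal.span {x}) hū hū2 hϖbar hdim'
      haveI := hp'
      have hle : Ideal.span {x} ≤ p'.comap π := fun a ha => by
        rw [Ideal.mem_comap, hπ, Ideal.Quotient.eq_zero_iff_mem.mpr ha]
        exact zero_mem _
      have hmap : (p'.comap π).map π = p' :=
        Ideal.map_comap_of_surjective _ Ideal.Quotient.mk_surjective _
      refine ⟨p'.comap π, inferInstance, ?_, ?_, ?_⟩
      · let e : (R ⧸ Ideal.span {x}) ⧸ p' ≃+* R ⧸ p'.comap π :=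
          (Ideal.quotEquivOfEq hmap.symm).trans (DoubleQuot.quotQuotEquivQuotOfLE hle)
        exact isDiscreteValuationRing_of_ringEquiv e
      · rwa [Ideal.mem_comap]
      · have key : (p'.comap π ⊔ Ideal.span {u}).map π = (maximalIdeal R).map π := by
          rw [Ideal.map_sup, hmap, Ideal.map_span, Set.image_singleton, hsup',
            maximalIdeal_quotient_eq_map (Ideal.span {x})]
        have key' := congrArg (Ideal.comap π) key
        rw [Ideal.comap_map_of_surjective _ Ideal.Quotient.mk_surjective,
          Ideal.comap_map_of_surjective _ Ideal.Quotient.mk_surjective,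
          ← RingHom.ker_eq_comap_bot, hπ, Ideal.mk_ker,
          sup_eq_left.mpr (hle.trans le_sup_left),
          sup_eq_left.mpr ((Ideal.span_singleton_le_iff_mem _).mpr hxm)] at key'
        exact key'

/-- The `u`-free form: a regular local ring of positive dimension has, for every `ϖ ≠ 0`, a prime
`𝔭` with `R/𝔭` a discrete valuation ring and `ϖ ∉ 𝔭`. [folklore] -/
theorem exists_isPrime_isDiscreteValuationRing_quotient_not_mem_of_ne_zero (R : Type u)
    [CommRing R] [IsRegularLocalRing R] (h : ringKrullDim R ≠ 0) {ϖ : R} (hϖ0 : ϖ ≠ 0) :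
    ∃ (p : Ideal R) (_ : p.IsPrime), IsDiscreteValuationRing (R ⧸ p) ∧ ϖ ∉ p := by
  obtain ⟨u, hu, hu2⟩ := IsRegularLocalRing.exists_not_mem_sq (R := R) h
  obtain ⟨p, hp, hdvr, hϖ, -⟩ :=
    exists_isPrime_isDiscreteValuationRing_quotient_not_mem R hu hu2 hϖ0
  exact ⟨p, hp, hdvr, hϖ⟩

end Summit.ResolutionOfSingularities.ResolutionOfSingularities.Cruxes.EquisingularLiftNat.Sections
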